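import Literature.AnabelianGeometry.EtaleTheta.ThetaTwistTowerComapLevel
import Literature.AnabelianGeometry.EtaleTheta.Discharge.Sec4LevelSaturationThetaTwistTower

/-!
# [EtTh] Def. 4.1 (iv) «`μ_N`-saturated» ingredients for the ε-free `(β)` theta tower PULLED BACK ALONG `ψ : Γ → Compat₃′`: the torsion of
# `B₀(S)` over a `Γ`-set is the group of `μ_{N_n}`-valued families — cyclic, read off at one point, generated by one root of unity
# (Def. 3.3 (iii) p.299, Prop. 3.4 (ii) p.300, Def. 4.1 (iv) p.313 / PDF pp.73, 74, 87)

S. Mochizuki, *The étale theta function …*, Publ. RIMS **45** (2009) [MochizukiEtTh2009], §1 p.239 (PDF p.13) («`K_N := K(ζ_N, …)`»), Def. 3.3 (iii)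
p.299 (PDF p.73), Prop. 3.4 (ii) p.300 (PDF p.74) («`O_L^× ⥲ Ker(B₀ → Φ₀^gp)`»), Def. 4.1 (iv) p.313 (PDF p.87) («`μ_N`-saturated»); S. Mochizuki, *The
geometry of Frobenioids II* (2008), Def. 2.1 (i) p.16 («`μ_N(A) ≅ ℤ/Nℤ`»).  [cite: MochizukiEtTh2009, Def 4.1 (iv) p.313 (PDF p.87)]
PAGE CONVENTION for [EtTh]: «printed N (PDF p.M)», N = M + 226.

abc-iut cell, layer L2, seat abc-iut-L2-t3 (gen 10; [EtTh] §3/§4 lineage), lane «(β2)-PREP: COMAP MU-TORSION KIT» of the S2-repair of record (abc-iut-L2-lead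
R1257; (α) p504894 ✓, level kit p505827, (β1) abc-iut-L2-t2 `LogDivisorTowerComap`).  PROOF-ONLY; ADDITIVE; (β1)-INDEPENDENT.  abc-iut-L2-d2's
«MU-TORSION@FOURTH-MODEL» (p500836: (M1) torsion ⇔ `μ`-valued, (M2) action through the cyclotomic character, (M3) the `N`-torsion of `B₀(S)` is
cyclic generated by one `μ`-valued unit) is stated for `Compat₃′`-sets; here the SAME statements for the level-`n` action pulled back along ANY
`ψ : Γ →* Compat₃′` (abc-iut-w6-d058's `GaloisAction.comap`) on ANY connected `Γ`-set — the case of record being the closed subgroup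
`Γ := closure(Im φ) ≤ Compat₃′` of (α) — with abc-iut-L2-d2's function-level lemmas consumed BY NAME at `ψ g` (`actFn_fst_of_snd_eq_one`,
`actFn_snd_eq_one`, `mem_zpowers_of_pow_eq_one_muN`, `orderOf_zeta_one`), the generic `GaloisAction.exists_bZero_of_invariant` (p500836 §0), and
abc-iut-L2-t3's `divZeroHom_eq_diag_zpow_comap` (p505827).
* (M1) `snd_eq_one_of_pow_eq_one_comap` / `pow_N_eq_one_of_snd_eq_one_comap` / `isOfFinOrder_iff_snd_eq_one_comap`, `divZeroHom_eq_one_of_snd_eq_one_comap`;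
* (M2) `actFn_fst_of_snd_eq_one_comap` (the pulled-back action on `μ`-valued constants is the character at `ψ g`);
* (M3) `eq_of_snd_eq_one_of_fst_eq_comap`, `mem_zpowers_of_pow_eq_one_comap`, `orderOf_eq_orderOf_fst_comap`, **`exists_generator_of_fixed_comap`** and
  its UNITS form **`exists_units_generator_of_fixed_comap`** — verbatim the inputs (`hζ1`, `hord`, `hgen`) of abc-iut-w6-d037's
  `TemperedFrobenioid.isMuSaturated_of_bZero_generator` for a tempered Frobenioid over `Γ`-sets built from these data ((β2)).
HONEST FRAMING: class-(b) combinatorial design carrier (NOT the tempered Frobenioid of a Tate curve; its units are exactly the level roots of unity);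
[EtTh]/[FrdII] are refereed prerequisite papers; nothing here bears on [IUTchIII] Cor. 3.12 or asserts abc proved/refuted; typed ≠ proved.
-/

noncomputable section

namespace Literature.AnabelianGeometry.EtaleTheta

open CategoryTheory Opposite Function Literature.AlgebraicGeometry.Frobenioids Literature.AnabelianGeometry.SemiGraphs
  LogDivisorModel LogDivisorModel.GaloisAction LogDivisorTower TateTowerKummerTwistRShear LogDivisorModel.TateTowerThetaTwist

namespace ThetaTwistTowerTempered

open TateTowerKummerTwist (N N_dvd_M)

variable {Γ : Type} [Group Γ] (ψ : Γ →* Compat 3 thetaShear) (n : ℕ) {S : Action (Type 0) Γ}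

/-! ## §1 (M2)/(M1) at level `n` for the pulled-back action -/

/-- **(M2) for the pulled-back action**: on a `μ`-valued constant `(ζ, 1)`, `g ∈ Γ` acts through the level-`n` cyclotomic character of `ψ g`.
[cite: MochizukiEtTh2009, §1 p.239 (PDF p.13)] -/
theorem actFn_fst_of_snd_eq_one_comap (g : Γ) (x : (towerC₃sf.Z n).Fn) (hx : x.1.2 = 1) :
    (((towerC₃sf.act n).comap ψ).actFn g x).1 = (levelCharMod n (N n) (N_dvd_M n) ((ψ g : Compat 3 thetaShear) : Grp 3 thetaShear).right.1 x.1.1, 1) :=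
  actFn_fst_of_snd_eq_one n (ψ g) x hx

/-- The pulled-back action preserves `μ`-valuedness. [cite: MochizukiEtTh2009, §1 p.239 (PDF p.13)] -/
theorem actFn_snd_eq_one_comap (g : Γ) (x : (towerC₃sf.Z n).Fn) (hx : x.1.2 = 1) : (((towerC₃sf.act n).comap ψ).actFn g x).1.2 = 1 :=
  actFn_snd_eq_one n (ψ g) x hx

/-- **(M1) TORSION ⇒ `μ`-VALUED** in `B₀(S)` of a `Γ`-set: if `b^k = 1` (`k ≥ 1`) then every value of `b` has trivial skeleton part (ε = 0 on the
ε-free tower, `ℤ³` torsion-free). [cite: MochizukiEtTh2009, Prop 3.4 p.300 (PDF p.74)] -/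
theorem snd_eq_one_of_pow_eq_one_comap {b : ((towerC₃sf.act n).comap ψ).bZero S} {k : ℕ} (hk : 0 < k) (h : b ^ k = 1) (s : S.V) :
    (b.1 s).1.2 = 1 := by
  obtain ⟨e, he⟩ : ∃ e : TateTowerTheta.Exp, (b.1 s).1.2 = Multiplicative.ofAdd e := ⟨_, rfl⟩
  have h2 : (b.1 s).1.2 ^ k = 1 := congrArg (fun c : ((towerC₃sf.act n).comap ψ).bZero S => (c.1 s).1.2) h
  have h2' : Multiplicative.ofAdd e ^ k = (1 : Multiplicative TateTowerTheta.Exp) := by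
    rw [← he]
    exact h2
  rw [← ofAdd_nsmul] at h2'
  have h3 : k • e = 0 := ofAdd_eq_one.mp h2'
  have hε : e.1 = 0 := by
    have h1 := fst_eq_zero_of_towerC₃sf n (b.1 s)
    rw [he] at h1
    exact h1
  have hk' : (k : ℤ) ≠ 0 := by exact_mod_cast hk.ne'
  have hz : ∀ z : ℤ, k • z = 0 → z = 0 := fun z hz => by
    rw [nsmul_eq_mul] at hz
    exact (mul_eq_zero.mp hz).resolve_left hk'
  have h4 : e = 0 :=
    Prod.ext hε (Prod.ext (hz _ (congrArg (fun e : TateTowerTheta.Exp => e.2.1) h3))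
      (Prod.ext (hz _ (congrArg (fun e : TateTowerTheta.Exp => e.2.2.1) h3)) (hz _ (congrArg (fun e : TateTowerTheta.Exp => e.2.2.2) h3))))
  rw [he, h4, ofAdd_zero]
  rfl

/-- **`μ`-VALUED ⇒ TORSION of exponent `N_n = (n+1)!`.** [cite: MochizukiEtTh2009, §1 p.239 (PDF p.13)] -/
theorem pow_N_eq_one_of_snd_eq_one_comap {b : ((towerC₃sf.act n).comap ψ).bZero S} (h : ∀ s, (b.1 s).1.2 = 1) :
    b ^ ((N n : ℕ+) : ℕ) = 1 := by
  have hcard : Fintype.card (TateTowerKummerTwist.MuN n) = ((N n : ℕ+) : ℕ) := by rw [Fintype.card_multiplicative, ZMod.card]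
  refine Subtype.ext (funext fun s => Subtype.ext (Prod.ext ?_ ?_))
  · change (b.1 s).1.1 ^ ((N n : ℕ+) : ℕ) = 1
    have h1 : (b.1 s).1.1 ^ Fintype.card (TateTowerKummerTwist.MuN n) = 1 := pow_card_eq_one
    rwa [hcard] at h1
  · change (b.1 s).1.2 ^ ((N n : ℕ+) : ℕ) = 1
    rw [h s, one_pow]

/-- **TORSION of `B₀(S)` ⟺ `μ`-VALUED**, for the pulled-back action. [cite: MochizukiEtTh2009, Prop 3.4 p.300 (PDF p.74)] -/
theorem isOfFinOrder_iff_snd_eq_one_comap (b : ((towerC₃sf.act n).comap ψ).bZero S) : IsOfFinOrder b ↔ ∀ s, (b.1 s).1.2 = 1 :=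
  ⟨fun hb s => by
    obtain ⟨k, hk, hbk⟩ := hb.exists_pow_eq_one
    exact snd_eq_one_of_pow_eq_one_comap ψ n hk hbk s,
    fun h => isOfFinOrder_iff_pow_eq_one.mpr ⟨_, PNat.pos _, pow_N_eq_one_of_snd_eq_one_comap ψ n h⟩⟩

/-- **A `μ`-valued family has trivial log-divisor** (Prop. 3.4 (ii): `μ ⊆ O_L^× = Ker(B₀ → Φ₀^gp)`). [cite: MochizukiEtTh2009, Prop 3.4 p.300 (PDF p.74)] -/
theorem divZeroHom_eq_one_of_snd_eq_one_comap {b : ((towerC₃sf.act n).comap ψ).bZero S} (h : ∀ s, (b.1 s).1.2 = 1) :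
    ((towerC₃sf.act n).comap ψ).divZeroHom S b = 1 := by
  have h' : ∀ s, Multiplicative.toAdd (b.1 s).1.2 = (((0 : ZMod 2), (0 : ℤ), (0 : ℤ), (0 : ℤ)) : TateTowerTheta.Exp) := fun s => by
    rw [h s]
    rfl
  exact (divZeroHom_eq_diag_zpow_comap ψ n h').trans (zpow_zero _)

/-! ## §2 (M3) The `N`-torsion of `B₀(S)` is cyclic of order `N`, generated by one `μ`-valued family -/

/-- Evaluation at `s₀` detects `μ`-valued families (connected `S`). [cite: MochizukiEtTh2009, Def 3.3 (iii) p.299 (PDF p.73)] -/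
theorem eq_of_snd_eq_one_of_fst_eq_comap (hS : isConnectedGSet S) (s₀ : S.V) {b c : ((towerC₃sf.act n).comap ψ).bZero S}
    (hb : ∀ s, (b.1 s).1.2 = 1) (hc : ∀ s, (c.1 s).1.2 = 1) (h : (b.1 s₀).1.1 = (c.1 s₀).1.1) : b = c := by
  have h0 : b.1 s₀ = c.1 s₀ := Subtype.ext (Prod.ext h ((hb s₀).trans (hc s₀).symm))
  refine Subtype.ext (funext fun s => ?_)
  obtain ⟨g, rfl⟩ := hS.2 s₀ s
  rw [b.2.2 g s₀, c.2.2 g s₀, h0]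

/-- Powers of a `μ`-valued family are `μ`-valued, with `μ`-coordinate the power. [cite: MochizukiEtTh2009, §1 p.239 (PDF p.13)] -/
theorem zpow_apply_fst_comap {ζ₀ : ((towerC₃sf.act n).comap ψ).bZero S} (hζ : ∀ s, (ζ₀.1 s).1.2 = 1) (k : ℤ) (s : S.V) :
    ((ζ₀ ^ k).1 s).1.1 = (ζ₀.1 s).1.1 ^ k ∧ ((ζ₀ ^ k).1 s).1.2 = 1 := by
  constructor
  · rfl
  · change (ζ₀.1 s).1.2 ^ k = 1
    rw [hζ s, one_zpow]

/-- **A `μ`-valued family whose root of unity at `s₀` has order `N` GENERATES the `N`-torsion of `B₀(S)`** (`S` a connected `Γ`-set).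
[cite: MochizukiFrdII2008, Def 2.1 (i) p.16] -/
theorem mem_zpowers_of_pow_eq_one_comap (hS : isConnectedGSet S) (s₀ : S.V) {ζ₀ : ((towerC₃sf.act n).comap ψ).bZero S}
    (hζ : ∀ s, (ζ₀.1 s).1.2 = 1) {K : ℕ} (hK : 0 < K) (hord : orderOf (ζ₀.1 s₀).1.1 = K) {b : ((towerC₃sf.act n).comap ψ).bZero S}
    (hb : b ^ K = 1) : b ∈ Subgroup.zpowers ζ₀ := by
  have hbμ := snd_eq_one_of_pow_eq_one_comap ψ n hK hb
  have hx : (b.1 s₀).1.1 ^ K = 1 :=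
    congrArg (fun c : ((towerC₃sf.act n).comap ψ).bZero S => ((c.1 s₀).1.1 : TateTowerKummerTwist.MuN n)) hb
  obtain ⟨k, hk⟩ := Subgroup.mem_zpowers_iff.mp (mem_zpowers_of_pow_eq_one_muN n hK hord hx)
  refine Subgroup.mem_zpowers_iff.mpr ⟨k, eq_of_snd_eq_one_of_fst_eq_comap ψ n hS s₀ (fun s => (zpow_apply_fst_comap ψ n hζ k s).2) hbμ ?_⟩
  rw [(zpow_apply_fst_comap ψ n hζ k s₀).1, hk]

/-- The order of a `μ`-valued family is the order of its root of unity at any point of a connected `S`. [cite: MochizukiEtTh2009, §1 p.239 (PDF p.13)] -/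
theorem orderOf_eq_orderOf_fst_comap (hS : isConnectedGSet S) (s₀ : S.V) {ζ₀ : ((towerC₃sf.act n).comap ψ).bZero S}
    (hζ : ∀ s, (ζ₀.1 s).1.2 = 1) : orderOf ζ₀ = orderOf (ζ₀.1 s₀).1.1 := by
  refine Nat.dvd_antisymm (orderOf_dvd_iff_pow_eq_one.mpr ?_) (orderOf_dvd_iff_pow_eq_one.mpr ?_)
  · refine (zpow_natCast ζ₀ _).symm.trans (eq_of_snd_eq_one_of_fst_eq_comap ψ n hS s₀ (fun s => (zpow_apply_fst_comap ψ n hζ _ s).2)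
      (fun _ => rfl) ?_)
    rw [(zpow_apply_fst_comap ψ n hζ _ s₀).1, zpow_natCast, pow_orderOf_eq_one]
    rfl
  · exact congrArg (fun c : ((towerC₃sf.act n).comap ψ).bZero S => ((c.1 s₀).1.1 : TateTowerKummerTwist.MuN n)) (pow_orderOf_eq_one ζ₀)

/-- **(M3) for the pulled-back action: THE `N`-TORSION OF `B₀(S)` IS CYCLIC OF ORDER `N`, GENERATED BY A `μ`-VALUED FAMILY OF TRIVIAL DIVISOR**
— whenever the stabiliser in `Γ` of a point `s₀` of the connected `Γ`-set `S` fixes some `μ`-valued value `x₁` whose root of unity has order divisible by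
`N`. [cite: MochizukiEtTh2009, Def 4.1 (iv) p.313 (PDF p.87)] -/
theorem exists_generator_of_fixed_comap (hS : isConnectedGSet S) (s₀ : S.V) (x₁ : (towerC₃sf.Z n).Fn) (hx₁ : x₁.1.2 = 1)
    (hfix : ∀ g : Γ, S.ρ g s₀ = s₀ → ((towerC₃sf.act n).comap ψ).actFn g x₁ = x₁) {K : ℕ} (hK : 0 < K) (hdvd : K ∣ orderOf x₁.1.1) :
    ∃ ζ₀ : ((towerC₃sf.act n).comap ψ).bZero S, (∀ s, (ζ₀.1 s).1.2 = 1) ∧ ((towerC₃sf.act n).comap ψ).divZeroHom S ζ₀ = 1 ∧ orderOf ζ₀ = K ∧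
      ∀ b : ((towerC₃sf.act n).comap ψ).bZero S, b ^ K = 1 → b ∈ Subgroup.zpowers ζ₀ := by
  set e : ℕ := orderOf x₁.1.1 / K with he
  have hxe2 : (x₁ ^ e).1.2 = 1 := by
    change x₁.1.2 ^ e = 1
    rw [hx₁, one_pow]
  have hxe1 : (x₁ ^ e).1.1 = x₁.1.1 ^ e := rfl
  have hord0 : orderOf x₁.1.1 ≠ 0 := (orderOf_pos x₁.1.1).ne'
  have horde : orderOf (x₁ ^ e).1.1 = K := by rw [hxe1, he, orderOf_pow_orderOf_div hord0 hdvd]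
  have hfixe : ∀ g : Γ, S.ρ g s₀ = s₀ → ((towerC₃sf.act n).comap ψ).actFn g (x₁ ^ e) = x₁ ^ e := fun g hg => by
    rw [map_pow, hfix g hg]
  obtain ⟨ζ₀, hζ₀⟩ := ((towerC₃sf.act n).comap ψ).exists_bZero_of_invariant hS s₀ (f := x₁ ^ e) trivial hfixe
  have hζμ : ∀ s, (ζ₀.1 s).1.2 = 1 := fun s => by
    obtain ⟨g, rfl⟩ := hS.2 s₀ s
    rw [ζ₀.2.2 g s₀, hζ₀]
    exact actFn_snd_eq_one_comap ψ n g _ hxe2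
  have hordζ : orderOf (ζ₀.1 s₀).1.1 = K := by rw [hζ₀, horde]
  exact ⟨ζ₀, hζμ, divZeroHom_eq_one_of_snd_eq_one_comap ψ n hζμ, (orderOf_eq_orderOf_fst_comap ψ n hS s₀ hζμ).trans hordζ,
    fun b hb => mem_zpowers_of_pow_eq_one_comap ψ n hS s₀ hζμ hK hordζ hb⟩

/-- **(M3) in UNITS form** (the shape abc-iut-w6-d037's `isMuSaturated_of_bZero_generator` consumes): a unit `u` of `B₀(S)` with `div₀ u = 1`,
`orderOf u = K`, generating the `K`-torsion of `B₀(S)ˣ`. [cite: MochizukiEtTh2009, Def 4.1 (iv) p.313 (PDF p.87)] -/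
theorem exists_units_generator_of_fixed_comap (hS : isConnectedGSet S) (s₀ : S.V) (x₁ : (towerC₃sf.Z n).Fn) (hx₁ : x₁.1.2 = 1)
    (hfix : ∀ g : Γ, S.ρ g s₀ = s₀ → ((towerC₃sf.act n).comap ψ).actFn g x₁ = x₁) {K : ℕ} (hK : 0 < K) (hdvd : K ∣ orderOf x₁.1.1) :
    ∃ u : (↥(((towerC₃sf.act n).comap ψ).bZero S))ˣ,
      ((towerC₃sf.act n).comap ψ).divZeroHom S (u : ↥(((towerC₃sf.act n).comap ψ).bZero S)) = 1 ∧ orderOf u = K ∧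
        ∀ b : (↥(((towerC₃sf.act n).comap ψ).bZero S))ˣ, b ^ K = 1 → b ∈ Subgroup.zpowers u := by
  obtain ⟨ζ₀, -, hdiv, hord, hgen⟩ := exists_generator_of_fixed_comap ψ n hS s₀ x₁ hx₁ hfix hK hdvd
  refine ⟨toUnits ζ₀, hdiv, (orderOf_injective toUnits.toMonoidHom toUnits.injective ζ₀).trans hord, fun b hb => ?_⟩
  have hb' : (b : ↥(((towerC₃sf.act n).comap ψ).bZero S)) ^ K = 1 := by
    rw [← Units.val_pow_eq_pow_val, hb, Units.val_one]
  obtain ⟨k, hk⟩ := Subgroup.mem_zpowers_iff.mp (hgen _ hb')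
  refine Subgroup.mem_zpowers_iff.mpr ⟨k, ?_⟩
  rw [← map_zpow, hk]
  exact toUnits_val_apply b

/-- **(M3) at the canonical fixed value**: if the stabiliser of `s₀` acts with trivial index-`m` character coordinate (`m ≤ n`) then it fixes the
level-`n` constant `ζ_{N_m}` (abc-iut-L2-d2's character adapter `actFn_zetaImage_eq_of_right_eq_one` at `ψ g`), whose root of unity has order
`N_m`; so for every `K ∣ N_m` the `K`-torsion of `B₀(S)ˣ` is cyclic of order `K` with a generator of trivial divisor — the `hsat`-shape input of the
Prop. 4.2 (iii) reduction at a (β2) carrier. [cite: MochizukiEtTh2009, Def 4.1 (iv) p.313 (PDF p.87)] -/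
theorem exists_units_generator_of_charTrivial_comap (hS : isConnectedGSet S) (s₀ : S.V) {m : ℕ} (hmn : m ≤ n)
    (hχ : ∀ g : Γ, S.ρ g s₀ = s₀ → ((ψ g : Compat 3 thetaShear) : Grp 3 thetaShear).right.1 m = 1) {K : ℕ} (hK : 0 < K)
    (hdvd : K ∣ ((N m : ℕ+) : ℕ)) :
    ∃ u : (↥(((towerC₃sf.act n).comap ψ).bZero S))ˣ,
      ((towerC₃sf.act n).comap ψ).divZeroHom S (u : ↥(((towerC₃sf.act n).comap ψ).bZero S)) = 1 ∧ orderOf u = K ∧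
        ∀ b : (↥(((towerC₃sf.act n).comap ψ).bZero S))ˣ, b ^ K = 1 → b ∈ Subgroup.zpowers u := by
  refine exists_units_generator_of_fixed_comap ψ n hS s₀
    ⟨zeta (TateTowerKummerTwist.MuN n)
      (Multiplicative.ofAdd ((((N n : ℕ+) : ℕ) / ((N m : ℕ+) : ℕ) : ℕ) : ZMod (N n))), rfl⟩ rfl
    (fun g hg => actFn_zetaImage_eq_of_right_eq_one hmn (ψ g) (hχ g hg)) hK ?_
  change K ∣ orderOf (Multiplicative.ofAdd _)
  rw [orderOf_zetaImage hmn]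
  exact hdvd

end ThetaTwistTowerTempered

end Literature.AnabelianGeometry.EtaleTheta

end
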